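import Mathlib

/-!
# `Balaban1983to89.B3Prop1` — T. Bałaban, *(Higgs)₂,₃ quantum fields in a finite volume. III. Renormalization*,
Commun. Math. Phys. **88** (1983) 411–445 [Balaban1983Higgs3]: the three propositions of the paper sharing the basic estimate
(1.33) — **Proposition 1** (Sect. 1, pp. 420–421), **Proposition 2.1** (p. 424), **Proposition 2.2** (p. 428) — with the Sect. 1
objects they speak about: the vertex catalogue (1.6)–(1.15), the orders `d_s`, `d_v`, the Hölder norm (1.32)

statement-level skeleton of published theorems with citation tags; proofs where landed; nothing here is a claim about the Yang–Mills mass gap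

PDF held: `paper:balaban1983-higgs-2-3-quantum-fields-finite-volume` (journal page = PDF page + 410).  Renders read as images for
every quotation below: `run/shared/lean/pub/pub-balaban/b2b-balaban-ref1/pages/1983-cmp88-higgs23-III/1983-cmp88-higgs23-III-p003,
p004, p010, p011-x4.png` (journal pp. 413, 414, 420, 421); the OCR layer of this paper garbles every display and was used only to
locate pages.

CITATION HEADER (lean-in-tree rule).  This module is part of the lit-balaban TYPED SKELETON (HOME `run/shared/lean/pub/lit-balaban/`,
SKELETON rows B3-03 … B3-12, B3-15, B3-22 of `HOME/lit-balaban-r15/SKELETON-r15.md`).  WHAT IS REPRODUCED: (a) the printed vertex catalogue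
(1.6)–(1.15) p. 413–414 as DATA — for each kind of vertex the number of factors η, of scalar legs, of legs of the fluctuation
vector field A′, of legs of the external vector field Ã, and of lattice differentiations, read off the printed displays
(`VertexKind`, `VertexKind.etaCount`, …); these counts are exactly what the degree (2.1) of Sect. 2 consumes (sibling module
`…B3Sect2Statements`); (b) the orders d_s(v), d_v(v) in λ and e (p. 420) as functions on the catalogue; (c) an abstract CARRIER
`Expansion` naming the objects of Proposition 1 — renormalized classes G_ren, localizations {□(v)}, external fields with their
localizing functions h, h′, the expression E(G_ren, {□(v)}, Φ_ext, A_ext), the tree length d({□(v)}), the Hölder norms (1.32) — as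
fields, with the printed standing facts (positivity of the running couplings, non-negativity of lengths and norms) as Prop
fields; (d) the display (1.33) at given constants (`Ineq133`) and **Proposition 1** (`Prop1`) with the printed dependence of the
constants made explicit by quantifier position: δ₀ ("depends on the dimension d only") BEFORE α₀ and n̄, the constant O(1)
("depends on α₀, n̄ … and is independent of ε, k, the domains Ω, Ω₁, Ω₂, the vector field B̃") AFTER α₀, n̄ and BEFORE the datum;
(e) over the extension `GraphExpansion` of the carrier (graphs G with their one-element classes {G}, connectedness, connected
subgraphs with their degrees D(·) of (2.2)–(2.3) and the predicate "is the graph (2.4)") **Proposition 2.1** (`Prop21`: (1.33)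
for G_ren = {G} when every connected subgraph of G other than (2.4) has positive degree) and **Proposition 2.2** (`Prop22`: the
same statement for the family of GENERALIZED expressions and graphs of p. 428 — "vertices with an arbitrary number of legs and
arbitrary power of η … lines … with arbitrary dimensions instead of −d+2", provided the propagators satisfy (2.6), (2.10)–(2.12));
the concrete degree arithmetic (2.1)–(2.3), (2.17) and Corollary 2.3 are the sibling module `…B3Sect2Statements`.
Carrier clauses (referee F6): the lattice T_η, the sets Ω ⊃ Ω₂, Ω₁ "sums of big blocks", the regularity conditions on B̃ of p. 412
("|Ã|, |∂^ηÃ|, |∂^ηB̃| and their Hölder norms with exponent α₀ are ≤ O(1)p(L^kε) and dist(supp Ã, ∂Ω) ≥ 2r(L^kε)"), the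
construction of the classes G_ren (Sect. 2) and of the localizations (p. 420), the propagators and the kernels (1.16) live INSIDE
the index of the family and the carrier fields; they are not modelled.  (Higgs)₂,₃ objects are not the Yang–Mills objects of the
cell's `Setup` vocabulary, so — like the sibling context modules `…Balaban1983to89.B1`, `.B2`, `.B3` — nothing of `Setup` is
restated; this file imports Mathlib only.  NOTHING of the paper is asserted: `Prop1`, `Prop21`, `Prop22` are `def … : Prop` consumed
downstream only as hypotheses until `_holds` theorems land (printed proofs: Prop. 2.1 pp. 424–428, Prop. 1 = Sect. 3 pp. 432–445).
Kernel-checked here: only definitional bookkeeping (`prop1_iff`; `prop21_of_prop1` = the trivial direction "Prop. 1 ⇒ Prop. 2.1";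
`Ineq133At.mono`; the `d_s`/`d_v` values of the catalogue).  Unit `lit-balaban-r15`
(reader/typer r15); companion prose `HOME/lit-balaban-r15/SKELETON-r15.md`.
-/

namespace Literature.MathematicalPhysics.QuantumFieldTheory.Balaban1983to89.B3Prop1

/-! ## The vertex catalogue (1.6)–(1.15), pp. 413–414, as data -/

/-- The kinds of vertices of the perturbation expansion, pp. 413–414 [PDF 3–4], verbatim: *"The first two describe
self-interaction of scalar fields: −λ(L^kε) Σ_{x∈Ω₁} η^d|φ′(x)|⁴, φ′(x) is a scalar field leg, (1.6)
−½ Σ_{x∈Ω₁} η^d δm_i²(x)(L^kε)²|φ′(x)|², δm_i²(x) is one of the renormalization mass counterterms. (1.7) The next group of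
vertices describes an interaction of scalar and vector fields:
(e(L^kε))^{n+n′} ((−1)^{n+n′}η^{n+n′−1}/(n!n′!)) Σ_b η^d[(D^η_B̃ φ′)(b)·q^{n+n′}φ′(b₋)](g_kA′_b)^n(Ã_b)^{n′}, n, n′ ≤ n̄, n+n′ ≥ 1, (1.8)
and the corresponding R-vertices (e(L^kε))^{n+n̄+1}((−1)^{n+n̄+1}η^{n+n̄}/(n!(n̄+1)!)) Σ_b η^d[(D^η_B̃φ′)(b)·q^{n+n̄+1}
R_{n̄+1}(−ηqe(L^kε)Ã_b)φ′(b₋)](g_kA′_b)^n(Ã_b)^{n̄+1}, n ≤ n̄. (1.9) Furthermore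
(e(L^kε))^{n+n′}(η^{n+n′−2}/(n!n′!)) Σ_b η^d[φ′(b₋)·q^{n+n′}φ′(b₋)](g_kA′_b)^n(Ã_b)^{n′}, n+n′ even, n, n′ ≤ n̄, n+n′ ≥ 2, (1.10)
and the R-vertices (e(L^kε))^{n+n̄+1}((−1)^{n+n̄+1}η^{n+n̄−1}/(n!(n̄+1)!)) Σ_b η^d[φ′(b₋)·q^{n+n̄+1}R_{n̄+1}(−ηqe(L^kε)Ã_b)φ′(b₋)]
(g_kA′_b)^n(Ã_b)^{n̄+1}. (1.11) … φ(y), y ∈ T₁^{(k)} ∩ Ω, (1.12) −(Q_k(B̃)φ′)(y) = −Σ_{x∈B^k(y)} η^d U(B̃(Γ^{(k)}_{y,x}))φ′(x), (1.13)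
−(e(L^kε))^{n+n′}(1/(n!n′!)) Σ_{x∈B^k(y)} η^d(A′(Γ^{(k)}_{y,x}))^n(Ã(Γ^{(k)}_{y,x}))^{n′}q^{n+n′}U(B̃(Γ^{(k)}_{y,x}))φ′(x), n, n′ ≤ n̄,
n+n′ ≥ 1, (1.14) and the R-vertices −(e(L^kε))^{n+n̄+1}(1/(n!(n̄+1)!)) Σ_{x∈B^k(y)} η^d(A′(Γ^{(k)}_{y,x}))^n(Ã(Γ^{(k)}_{y,x}))^{n̄+1}
q^{n+n̄+1}R_{n̄+1}(qe(L^kε)Ã(Γ^{(k)}_{y,x}))U(B̃(Γ^{(k)}_{y,x}))φ′(x), n ≤ n̄. (1.15)"*; p. 414: *"In the sequel we will treat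
(1.13)–(1.15) as the vertices, and (1.12) is an external field."*  Typed reading: one constructor per display, parametrised by
the printed integers n (legs of A′) and n′ (legs of Ã); for the R-vertices (1.9), (1.11), (1.15) the printed n′ is n̄ + 1 and is
carried as the parameter `nbar`.  The side conditions "n, n′ ≤ n̄, n + n′ ≥ 1", … are NOT part of the type (see `Admissible`).
[cite: Balaban1983Higgs3, (1.6)–(1.15) pp.413–414] -/
inductive VertexKind
  /-- (1.6): the φ⁴ vertex. -/
  | v16
  /-- (1.7): the mass renormalization vertex. -/
  | v17
  /-- (1.8) with n legs of A′ and n′ legs of Ã. -/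
  | v18 (n n' : ℕ)
  /-- (1.9): the R-vertex of (1.8), n legs of A′, n̄ + 1 legs of Ã. -/
  | v19 (n nbar : ℕ)
  /-- (1.10) with n legs of A′ and n′ legs of Ã. -/
  | v110 (n n' : ℕ)
  /-- (1.11): the R-vertex of (1.10). -/
  | v111 (n nbar : ℕ)
  /-- (1.13): −(Q_k(B̃)φ′)(y). -/
  | v113
  /-- (1.14) with n legs of A′ and n′ legs of Ã. -/
  | v114 (n n' : ℕ)
  /-- (1.15): the R-vertex of (1.14). -/
  | v115 (n nbar : ℕ)
  deriving DecidableEq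

namespace VertexKind

/-- The printed side conditions of the catalogue for the expansion parameter n̄, pp. 413–414 [PDF 3–4], verbatim: (1.8) *"n, n′ ≤ n̄,
n + n′ ≥ 1"*; (1.9) *"n ≤ n̄"*; (1.10) *"n + n′ even, n, n′ ≤ n̄, n + n′ ≥ 2"*; (1.11) (as (1.9)); (1.14) *"n, n′ ≤ n̄, n + n′ ≥ 1"*;
(1.15) *"n ≤ n̄"*; for the R-vertices the Ã-exponent is n̄ + 1. [cite: Balaban1983Higgs3, (1.8)–(1.15) pp.413–414] -/
def Admissible (nbar : ℕ) : VertexKind → Prop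
  | v16 => True
  | v17 => True
  | v18 n n' => n ≤ nbar ∧ n' ≤ nbar ∧ 1 ≤ n + n'
  | v19 n nb => nb = nbar ∧ n ≤ nbar
  | v110 n n' => Even (n + n') ∧ n ≤ nbar ∧ n' ≤ nbar ∧ 2 ≤ n + n'
  | v111 n nb => nb = nbar ∧ n ≤ nbar
  | v113 => True
  | v114 n n' => n ≤ nbar ∧ n' ≤ nbar ∧ 1 ≤ n + n'
  | v115 n nb => nb = nbar ∧ n ≤ nbar

/-- Number of factors η in the vertex (the dimension count of p. 422 gives each factor η the dimension +1), read off the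
displays of pp. 413–414 with the space dimension `d` (the factor η^d of every lattice sum) made explicit: (1.6), (1.7), (1.13),
(1.14), (1.15): η^d; (1.8): η^d·η^{n+n′−1}; (1.9): η^d·η^{n+n̄}; (1.10): η^d·η^{n+n′−2}; (1.11): η^d·η^{n+n̄−1}.  Typed over ℤ so that
the printed exponents are polynomial expressions (no truncated subtraction); for admissible parameters they are ≥ 0
(`etaCount_nonneg`). [cite: Balaban1983Higgs3, (1.6)–(1.15) pp.413–414] -/
def etaCount (d : ℕ) : VertexKind → ℤ
  | v16 => d
  | v17 => d
  | v18 n n' => d + n + n' - 1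
  | v19 n nb => d + n + nb
  | v110 n n' => d + n + n' - 2
  | v111 n nb => d + n + nb - 1
  | v113 => d
  | v114 _ _ => d
  | v115 _ _ => d

/-- Number of scalar-field legs φ′ of the vertex: 4 for (1.6), 2 for (1.7)–(1.11), 1 for (1.13)–(1.15) (pp. 413–414).
[cite: Balaban1983Higgs3, (1.6)–(1.15) pp.413–414] -/
def scalarLegs : VertexKind → ℕ
  | v16 => 4
  | v17 => 2
  | v18 _ _ => 2
  | v19 _ _ => 2
  | v110 _ _ => 2
  | v111 _ _ => 2
  | v113 => 1
  | v114 _ _ => 1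
  | v115 _ _ => 1

/-- Number of legs of the fluctuation vector field A′ (the factors (g_kA′_b)^n, resp. (A′(Γ^{(k)}_{y,x}))^n): the printed n;
0 for (1.6), (1.7), (1.13).  p. 414: *"All the A′-legs are contracted, i.e. they are divided into pairs and each pair is replaced by
the corresponding propagator."* [cite: Balaban1983Higgs3, (1.6)–(1.15) pp.413–414] -/
def vectorLegs : VertexKind → ℕ
  | v16 => 0
  | v17 => 0
  | v18 n _ => n
  | v19 n _ => n
  | v110 n _ => n
  | v111 n _ => n
  | v113 => 0
  | v114 n _ => n
  | v115 n _ => n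

/-- Number of legs of the EXTERNAL vector field Ã (the factors (Ã_b)^{n′}, resp. (Ã(Γ))^{n′}): the printed n′, and n̄ + 1 for the
R-vertices; such legs are external fields and have dimension 0 in the count of p. 422.
[cite: Balaban1983Higgs3, (1.6)–(1.15) pp.413–414] -/
def extVectorLegs : VertexKind → ℕ
  | v16 => 0
  | v17 => 0
  | v18 _ n' => n'
  | v19 _ nb => nb + 1
  | v110 _ n' => n'
  | v111 _ nb => nb + 1
  | v113 => 0
  | v114 _ n' => n'
  | v115 _ nb => nb + 1

/-- Number of lattice differentiations in the vertex: the one covariant derivative D^η_B̃ of (1.8), (1.9); none otherwise.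
[cite: Balaban1983Higgs3, (1.6)–(1.15) pp.413–414] -/
def diffCount : VertexKind → ℕ
  | v18 _ _ => 1
  | v19 _ _ => 1
  | _ => 0

/-- The vertices "of the form (1.14) and (1.15)", whose A′-legs carry the extra summand of the degree (2.1) p. 422 (p. 426: *"If a
leg A′ of the line is in one of the vertices (1.14) and (1.15), then we have the expression A′^{(j),η}(Γ^{j+1}_{x_{j+1},x}) on the
basis of (1.3). For each such expression we have an additional factor L^jη"*). [cite: Balaban1983Higgs3, (2.1) p.422] -/
def isAveragingVertex : VertexKind → Bool
  | v114 _ _ => true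
  | v115 _ _ => true
  | _ => false

/-- The vertices "of the form (1.13)–(1.15)" (Corollary 2.3 p. 429). [cite: Balaban1983Higgs3, Cor. 2.3 p.429] -/
def isOfForm1315 : VertexKind → Bool
  | v113 => true
  | v114 _ _ => true
  | v115 _ _ => true
  | _ => false

/-- The R-vertices (1.9), (1.11), (1.15) (Corollary 2.3 p. 429: *"or an R-vertex"*). [cite: Balaban1983Higgs3, Cor. 2.3 p.429] -/
def isRVertex : VertexKind → Bool
  | v19 _ _ => true
  | v111 _ _ => true
  | v115 _ _ => true
  | _ => false

/-- d_s(v), p. 420 [PDF 10], verbatim: *"Let us denote by d_s(v) an order of the coupling constant λ for the vertex v"* — read off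
the catalogue: 1 for (1.6), 0 otherwise (the counterterm vertex (1.7) carries its order through δm²_G, (1.29), not through an
explicit factor; typed 0 here and recorded as a reading). [cite: Balaban1983Higgs3, p.420] -/
def ds : VertexKind → ℕ
  | v16 => 1
  | _ => 0

/-- d_v(v), p. 420 [PDF 10], verbatim: *"and by d_v(v) an order of the coupling constant e"* — the exponent of e(L^kε) printed in
(1.8)–(1.11), (1.14)–(1.15): n + n′, resp. n + n̄ + 1; 0 for (1.6), (1.7), (1.13). [cite: Balaban1983Higgs3, p.420] -/
def dv : VertexKind → ℕ
  | v16 => 0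
  | v17 => 0
  | v18 n n' => n + n'
  | v19 n nb => n + nb + 1
  | v110 n n' => n + n'
  | v111 n nb => n + nb + 1
  | v113 => 0
  | v114 n n' => n + n'
  | v115 n nb => n + nb + 1

/-- kernel: d_v(v) = (legs of A′) + (legs of Ã) for every vertex of the catalogue — each vector leg, internal or external, carries
one factor e(L^kε) (definitional bookkeeping over the printed data above). [cite: Balaban1983Higgs3, (1.8)–(1.15) pp.413–414] -/
theorem dv_eq_vectorLegs_add (v : VertexKind) : v.dv = v.vectorLegs + v.extVectorLegs := by
  cases v <;> simp [dv, vectorLegs, extVectorLegs] <;> omega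

/-- kernel: for admissible parameters and space dimension d ≥ 1 the printed η-exponents are non-negative (n + n′ ≥ 1,
resp. ≥ 2; for (1.11) the exponent n + n̄ − 1 needs d ≥ 1 when n = n̄ = 0) — bookkeeping over the printed exponents.
[cite: Balaban1983Higgs3, (1.6)–(1.15) pp.413–414] -/
theorem etaCount_nonneg (d nbar : ℕ) (hd : 1 ≤ d) (v : VertexKind) (hv : v.Admissible nbar) : 0 ≤ v.etaCount d := by
  cases v <;> simp [Admissible, etaCount] at * <;> omega

end VertexKind

/-- d_s(G), d_v(G), p. 420 [PDF 10], verbatim: *"Finally let d_s(G) = Σ_{v∈G} d_s(v), d_v(G) = Σ_{v∈G} d_v(v). The numbers d_s(G),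
d_v(G) are well-defined for G_ren because all graphs in the family G_ren have the same orders."* — for a finite family of vertices
indexed by `ι`. [cite: Balaban1983Higgs3, p.420] -/
def dsOf {ι : Type} (V : Finset ι) (kind : ι → VertexKind) : ℕ := ∑ v ∈ V, (kind v).ds

/-- d_v(G) = Σ_{v∈G} d_v(v), p. 420 [PDF 10] (see `dsOf` for the printed sentence), for a finite family of vertices indexed by
`ι`. [cite: Balaban1983Higgs3, p.420] -/
def dvOf {ι : Type} (V : Finset ι) (kind : ι → VertexKind) : ℕ := ∑ v ∈ V, (kind v).dv

/-! ## The carrier of Proposition 1 -/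

/-- Abstract carrier: the data of the perturbation expansion of Sect. 1 for ONE admissible datum (ε, k, Ω, Ω₁, Ω₂, B̃) and one
value of the expansion parameter n̄ — the objects about which (1.33) speaks, as fields.  p. 420 [PDF 10], verbatim: *"Let us
denote by E(G, {□(v)}_{v∈G}, Φ_ext, A_ext) the expression corresponding to graph G with localizations {□(v)}_{v∈G} and external
fields Φ_ext, A_ext. The same symbol with G_ren instead of G denotes a sum of these expressions for G ∈ G_ren."*; p. 419: *"we
will consider external fields in the form of functions Φ_ext(x, x′, x″, …), A_ext(y, y′, y″, …) of many variables instead of a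
product. We will need some norms for these functions. The basic norm is the Hölder norm ‖·‖_{1,α}"*; (1.32) p. 420: *"‖f‖_{1,α} =
sup_x |f(x)| + sup_{x,μ} |(D^η_{B̃,μ}f)(x)| + sup_{x,x′,μ} (1/|x′−x|^α)|U(B̃(Γ_{x,x′}))(D^η_{B̃,μ}f)(x′) − (D^η_{B̃,μ}f)(x)|, (1.32) where
Γ_{x,x′} is a shortest contour connecting x and x′. This definition extends in a natural way to functions of many variables. For
external vector fields we have the same definition, but with B̃ = 0."*  Carrier clauses (F6): lattices, domains, the field B̃ and its
regularity, the propagators, the classes G_ren and the agreement of localizations are inside the fields; `normS α` is the map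
(G_ren, {□(v)}, Φ_ext) ↦ ‖hΦ_ext‖_{1,α} INCLUDING the localizing functions h of p. 420 (*"if in a vertex v there is a leg of external
field, then we multiply it by a smooth function h such that h = 1 on □(v) and h = 0 outside some neighborhood of □(v)"*), `normV α`
likewise for ‖h′A_ext‖_{1,α}; `treeLen` is d({□(v)}_{v∈G_ren}) (*"a length of a shortest tree graph connecting the vertices v
localized in □(v), v ∈ G"* — cf. the continuum tree length of the sibling module `…Balaban1983to89.TreeLength`, which models
[Balaban1987RG1]'s d_j(X); not identified here). [cite: Balaban1983Higgs3, (1.32)–(1.33) p.420] -/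
structure Expansion where
  /-- e(L^kε), the running coupling of (1.8)–(1.15) ([Balaban1982Higgs1] (2.23): e(L^kε) = e·(L^kε)^{(4−d)/2}). -/
  eRun : ℝ
  /-- λ(L^kε), the running coupling of (1.6). -/
  lamRun : ℝ
  eRun_pos : 0 < eRun
  lamRun_pos : 0 < lamRun
  /-- The renormalized classes G_ren of the expansion (Sect. 2, pp. 429–432). -/
  RenClass : Type
  /-- The localizations {□(v)}_{v∈G_ren} of a class (p. 420; "localizations in these graphs should be in agreement", p. 432). -/
  Loc : RenClass → Type
  /-- External scalar fields Φ_ext (functions of many variables, p. 419). -/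
  ExtS : Type
  /-- External vector fields A_ext. -/
  ExtV : Type
  /-- E(G_ren, {□(v)}_{v∈G_ren}, Φ_ext, A_ext). -/
  E : (G : RenClass) → Loc G → ExtS → ExtV → ℝ
  /-- d_s(G_ren), the common order in λ. -/
  ds : RenClass → ℕ
  /-- d_v(G_ren), the common order in e. -/
  dv : RenClass → ℕ
  /-- d({□(v)}_{v∈G_ren}), the length of a shortest tree graph connecting the localization cubes. -/
  treeLen : (G : RenClass) → Loc G → ℝ
  treeLen_nonneg : ∀ (G : RenClass) (loc : Loc G), 0 ≤ treeLen G loc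
  /-- α ↦ ‖hΦ_ext‖_{1,α}, the Hölder norm (1.32) (with U(B̃(Γ))) of the localized external scalar fields. -/
  normS : ℝ → (G : RenClass) → Loc G → ExtS → ℝ
  /-- α ↦ ‖h′A_ext‖_{1,α}, the Hölder norm (1.32) with B̃ = 0 of the localized external vector fields. -/
  normV : ℝ → (G : RenClass) → Loc G → ExtV → ℝ
  normS_nonneg : ∀ α (G : RenClass) (loc : Loc G) (Φ : ExtS), 0 ≤ normS α G loc Φ
  normV_nonneg : ∀ α (G : RenClass) (loc : Loc G) (A : ExtV), 0 ≤ normV α G loc A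

/-! ## (1.33) and Proposition 1 -/

/-- **(1.33)** p. 420 [PDF 10] for ONE class G_ren of one datum, at given constants (α₀, δ₀, O(1) = `C`), verbatim:
*"|E(G_ren, {□(v)}_{v∈G_ren}, Φ_ext, A_ext)| ≤ O(1)(e(L^kε))^{d_v(G_ren)}(λ(L^kε))^{d_s(G_ren)} exp[−δ₀d({□(v)}_{v∈G_ren})]
· ‖hΦ_ext‖_{1,α₀}‖h′A_ext‖_{1,α₀}, (1.33)"* — for all localizations and all external fields. [cite: Balaban1983Higgs3, (1.33) p.420] -/
def Ineq133At (X : Expansion) (G : X.RenClass) (α₀ δ₀ C : ℝ) : Prop :=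
  ∀ (loc : X.Loc G) (Φ : X.ExtS) (A : X.ExtV),
    |X.E G loc Φ A| ≤ C * X.eRun ^ X.dv G * X.lamRun ^ X.ds G * Real.exp (-(δ₀ * X.treeLen G loc)) *
      X.normS α₀ G loc Φ * X.normV α₀ G loc A

/-- **(1.33)** for every renormalized class of the datum. [cite: Balaban1983Higgs3, (1.33) p.420] -/
def Ineq133 (X : Expansion) (α₀ δ₀ C : ℝ) : Prop :=
  ∀ G : X.RenClass, Ineq133At X G α₀ δ₀ C

/-- **Proposition 1** pp. 420–421 [PDF 10–11], verbatim: *"There exist positive constants δ₀, O(1) such that (1.33), where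
0 < α₀ < 1, d({□(v)}_{v∈G}) denotes a length of a shortest tree graph connecting the vertices v localized in □(v), v ∈ G, and the
functions h, h′ describes localizations of external fields. More exactly if in a vertex v there is a leg of external field, then we
multiply it by a smooth function h such that h = 1 on □(v) and h = 0 outside some neighborhood of □(v). The constant δ₀ depends on
the dimension d only (in estimates we always assume that a = 1 in the definition of the renormalization transformation and M is
fixed in an optimal way, i.e. the smallest possible). The constant O(1) depends on α₀, n̄ (in fact on n̄ only if α₀ is chosen not
too close to 0, e.g. if we take α₀ = ½), and is independent of ε, k, the domains Ω, Ω₁, Ω₂, the vector field B̃ (if they satisfy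
the conditions mentioned previously)."*  Typed reading, for a FAMILY `fam n̄ i` of expansions (i ranging over the admissible data
(ε, k, Ω, Ω₁, Ω₂, B̃) "satisfying the conditions mentioned previously" — p. 412: Ω, Ω₁ sums of big blocks, |Ã|, |∂^ηÃ|, |∂^ηB̃| and
their α₀-Hölder norms ≤ O(1)p(L^kε), dist(supp Ã, ∂Ω) ≥ 2r(L^kε); d, L, a = 1, M fixed for the family): ∃ δ₀ > 0 (chosen first:
"depends on d only"), ∀ α₀ ∈ (0, 1), ∀ n̄, ∃ O(1) > 0 (after α₀, n̄; before the datum), ∀ i, (1.33) for every class.  Carrier clauses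
(F6): see `Expansion`.  weaker-than-print: none intended; the parenthetical "on n̄ only if α₀ is not too close to 0" is not encoded.
[cite: Balaban1983Higgs3, Prop. 1 pp.420–421] -/
def Prop1 {I : Type} (fam : ℕ → I → Expansion) : Prop :=
  ∃ δ₀ : ℝ, 0 < δ₀ ∧ ∀ α₀ : ℝ, 0 < α₀ → α₀ < 1 → ∀ nbar : ℕ, ∃ C : ℝ, 0 < C ∧ ∀ i : I, Ineq133 (fam nbar i) α₀ δ₀ C

/-- Proposition 1 is exactly "∃ δ₀, ∀ α₀ ∈ (0,1), ∀ n̄, ∃ O(1), ∀ datum, ∀ G_ren, (1.33)" (definitional bookkeeping, `Iff.rfl`).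
[cite: Balaban1983Higgs3, Prop. 1 pp.420–421] -/
theorem prop1_iff {I : Type} (fam : ℕ → I → Expansion) :
    Prop1 fam ↔ ∃ δ₀ : ℝ, 0 < δ₀ ∧ ∀ α₀ : ℝ, 0 < α₀ → α₀ < 1 → ∀ nbar : ℕ, ∃ C : ℝ, 0 < C ∧
      ∀ (i : I) (G : (fam nbar i).RenClass), Ineq133At (fam nbar i) G α₀ δ₀ C :=
  Iff.rfl

/-- kernel (monotonicity in the constant, used when several printed O(1)'s are merged into one): (1.33) at `C` implies (1.33) at
any `C′ ≥ C`, because its right side is a product of non-negative factors. [cite: Balaban1983Higgs3, (1.33) p.420] -/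
theorem Ineq133At.mono {X : Expansion} {G : X.RenClass} {α₀ δ₀ C C' : ℝ} (h : Ineq133At X G α₀ δ₀ C) (hC : C ≤ C') :
    Ineq133At X G α₀ δ₀ C' := by
  intro loc Φ A
  refine (h loc Φ A).trans ?_
  have h1 : 0 ≤ X.eRun ^ X.dv G := pow_nonneg X.eRun_pos.le _
  have h2 : 0 ≤ X.lamRun ^ X.ds G := pow_nonneg X.lamRun_pos.le _
  have h3 : 0 ≤ Real.exp (-(δ₀ * X.treeLen G loc)) := (Real.exp_pos _).le
  have h4 := X.normS_nonneg α₀ G loc Φ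
  have h5 := X.normV_nonneg α₀ G loc A
  have : 0 ≤ X.eRun ^ X.dv G * X.lamRun ^ X.ds G * Real.exp (-(δ₀ * X.treeLen G loc)) *
      X.normS α₀ G loc Φ * X.normV α₀ G loc A := by positivity
  calc C * X.eRun ^ X.dv G * X.lamRun ^ X.ds G * Real.exp (-(δ₀ * X.treeLen G loc)) *
        X.normS α₀ G loc Φ * X.normV α₀ G loc A
      = C * (X.eRun ^ X.dv G * X.lamRun ^ X.ds G * Real.exp (-(δ₀ * X.treeLen G loc)) *
        X.normS α₀ G loc Φ * X.normV α₀ G loc A) := by ring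
    _ ≤ C' * (X.eRun ^ X.dv G * X.lamRun ^ X.ds G * Real.exp (-(δ₀ * X.treeLen G loc)) *
        X.normS α₀ G loc Φ * X.normV α₀ G loc A) := mul_le_mul_of_nonneg_right hC this
    _ = C' * X.eRun ^ X.dv G * X.lamRun ^ X.ds G * Real.exp (-(δ₀ * X.treeLen G loc)) *
        X.normS α₀ G loc Φ * X.normV α₀ G loc A := by ring

/-! ## Propositions 2.1 and 2.2 (Sect. 2) over the same carrier -/

/-- Extension of the carrier by the graph data Propositions 2.1–2.2 speak about.  p. 415 [PDF 5], verbatim: *"Now a graph for us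
is a collection of internal lines, external legs, and vertices connected in the usual sense. There is at least one internal line,
and every internal line has a vertex at each endpoint. The construction of graphs is otherwise arbitrary."*; p. 424 [PDF 14]:
*"let us introduce the following special graph with a degree equal to 0: [display (2.4): two vertices of type (1.8), each with one
external scalar leg and one external vector leg, joined by one scalar line]"*.  Fields: the graphs `Graph`, the one-element class
G_ren = {G} (`single`), connectedness, the connected subgraphs of a graph with their degrees D(·) of (2.2)–(2.3) p. 423 (`subDeg`,
valued in ℚ: degrees are half-integers) and the predicate "is (a copy of) the graph (2.4)".  Carrier clauses (F6): which subgraphs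
are connected, the degree formula and the shape (2.4) are data of the instance; the concrete arithmetic of (2.1)–(2.3) is typed in
`…B3Sect2Statements` and is linked to `subDeg` by the instantiating seat. [cite: Balaban1983Higgs3, (2.4) p.424] -/
structure GraphExpansion extends Expansion where
  /-- The graphs of the expansion. -/
  Graph : Type
  /-- G ↦ the one-element renormalized class {G} ("Then we define G_ren = {G}", Prop. 2.1). -/
  single : Graph → RenClass
  /-- "G … a connected graph". -/
  Connected : Graph → Prop
  /-- The connected subgraphs of G (the whole graph included). -/
  Sub : Graph → Type
  /-- D(H) for a connected subgraph H, (2.2)–(2.3) p. 423. -/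
  subDeg : (G : Graph) → Sub G → ℚ
  /-- "H is one of the subgraphs (2.4)". -/
  Is24 : (G : Graph) → Sub G → Prop

/-- The hypothesis of Proposition 2.1, p. 424 [PDF 14], verbatim: *"Let G be a connected graph such that its each connected subgraph,
with the possible exception of the subgraphs (2.4), has a positive degree."* [cite: Balaban1983Higgs3, Prop. 2.1 p.424] -/
def PosSubgraphsExcept24 (X : GraphExpansion) (G : X.Graph) : Prop :=
  X.Connected G ∧ ∀ H : X.Sub G, X.Is24 G H ∨ 0 < X.subDeg G H

/-- **Proposition 2.1** p. 424 [PDF 14], verbatim: *"Let G be a connected graph such that its each connected subgraph, with the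
possible exception of the subgraphs (2.4), has a positive degree. Then we define G_ren = {G} and Proposition 1 holds in this
case."*  Typed reading: the quantifier shape of `Prop1` (δ₀ first; O(1) after α₀, n̄; then the datum), with (1.33) asserted for
the classes {G} of the graphs G satisfying `PosSubgraphsExcept24`.  Printed proof: pp. 424–428 ((2.5)–(2.16)).
[cite: Balaban1983Higgs3, Prop. 2.1 p.424] -/
def Prop21 {I : Type} (fam : ℕ → I → GraphExpansion) : Prop :=
  ∃ δ₀ : ℝ, 0 < δ₀ ∧ ∀ α₀ : ℝ, 0 < α₀ → α₀ < 1 → ∀ nbar : ℕ, ∃ C : ℝ, 0 < C ∧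
    ∀ (i : I) (G : (fam nbar i).Graph), PosSubgraphsExcept24 (fam nbar i) G →
      Ineq133At (fam nbar i).toExpansion ((fam nbar i).single G) α₀ δ₀ C

/-- **Proposition 2.2** p. 428 [PDF 18], verbatim (with the sentences it refers to): *"It is easily seen from the proof that the
theorem can be generalized to a much wider class of graphs and expressions. We can have vertices with an arbitrary number of legs
and arbitrary power of η. We can have lines with the same exponential factors but with arbitrary dimensions instead of −d+2. The
only thing which matters is that propagators have representations corresponding to (2.6) with the estimates corresponding to
(2.10)–(2.12), so that we have the inequality (2.13) with the proper generalization of (2.14). We can formulate these remarks as the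
theorem: Proposition 2.2. Proposition 2.1 holds for the described above generalized expressions and graphs."*  Typed reading: the
statement `Prop21` for a family `famGen` of GENERALIZED graph expansions; what makes a family "generalized in the described sense"
(arbitrary legs/η-powers/line dimensions, degrees computed with those dimensions, propagators with (2.6), (2.10)–(2.12)) is a
property of the instance and is the instantiating seat's to document — this declaration only fixes that Prop. 2.2 has the SAME
logical shape as Prop. 2.1 (F6).  Printed proof: "repeating the same reasoning as in the proof of (2.15)" (p. 428).
[cite: Balaban1983Higgs3, Prop. 2.2 p.428] -/
def Prop22 {I : Type} (famGen : ℕ → I → GraphExpansion) : Prop :=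
  Prop21 famGen

/-- kernel: Proposition 1 for a family implies Proposition 2.1 for it (the classes {G} are among all classes) — the trivial
direction; the paper proves Prop. 2.1 FIRST, as the model case of Prop. 1. [cite: Balaban1983Higgs3, Prop. 2.1 p.424] -/
theorem prop21_of_prop1 {I : Type} (fam : ℕ → I → GraphExpansion) (h : Prop1 fun nbar i => (fam nbar i).toExpansion) :
    Prop21 fam := by
  obtain ⟨δ₀, hδ, H⟩ := h
  refine ⟨δ₀, hδ, fun α₀ h0 h1 nbar => ?_⟩
  obtain ⟨C, hC, HC⟩ := H α₀ h0 h1 nbar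
  exact ⟨C, hC, fun i G _ => HC i ((fam nbar i).single G)⟩

end Literature.MathematicalPhysics.QuantumFieldTheory.Balaban1983to89.B3Prop1
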